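import Literature.Geometry.Lorentzian.Hypersurface
import Literature.Geometry.Lorentzian.GeodesicProofs
import Literature.Geometry.Lorentzian.CurveThroughVelocity
import HarnessLib

/-!
# The second fundamental form is `g(D_v ν, df w)` (discharge of `secondFundamentalForm_apply`)

This file discharges the named fact `PseudoRiemannianMetric.secondFundamentalForm_apply` of
`Hypersurface.lean`: if `y` is an interior point of `N` and the field `ν` along `f : N → M` is
differentiable at `y` as a map `N → TM`, then `K_ν(v, w) = g_{f y}(D_v ν, df_y w)` for *all*
`v, w ∈ T_y N` (`PseudoRiemannianMetric.secondFundamentalForm_apply_holds`), where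
`D_v ν = normalDerivAlong g f ν y v` is the covariant derivative of `ν` along the chart-straight
curve with velocity `v`, and `K_ν = secondFundamentalForm I' g f ν y` is, by definition, the
bilinear form agreeing with `(v, w) ↦ g(D_v ν, df w)` for `v` in the canonical basis of `T_y N`.
On the way: the chart-straight curve `curveThrough I x v` is differentiable at `t = 0` with
derivative `t ↦ t • v` at interior points (`hasMFDerivAt_curveThrough_zero`, complementing
`velocity_curveThrough_zero_holds` of `CurveThroughVelocity.lean`), the frame formula for the
covariant derivative along `t ↦ f (c t)` of `t ↦ ν (c t)` (`covariantDerivAlong_comp_eq`), and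
the resulting frame formula for `D_v ν`, linear in `v`
(`PseudoRiemannianMetric.normalDerivAlong_eq`).

## The printed proof and its formalisation

O'Neill 1983, Ch. 4, Lemma 1 and Cor. 2 (1) (pp. 98–99): for `V` tangent to the submanifold
and `X` a vector field of the ambient manifold along it, `D̄_V X` is well defined by the
coordinate formula `D̄_V X̄ = ∑ V(fⁱ) ∂ᵢ + ∑ fⁱ D̄_V ∂ᵢ` (`X̄ = ∑ fⁱ ∂ᵢ` a local extension) and
is `𝔉(M)`-linear in `V`, hence has "the pointwise character expressed by Proposition 2.2"
(Lemma 4, p. 100: at each point the shape tensor `II` determines an `ℝ`-bilinear function on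
`T_p M`). In the tree, `D_v ν` is the induced covariant derivative along a curve of Ch. 3,
Prop. 18, whose defining coordinate formula is `Z' = ∑ (dZⁱ/dt) ∂ᵢ + ∑ Zⁱ D_{α'} ∂ᵢ` (p. 66).
We prove exactly the pointwise version of O'Neill's computation: for a curve `c` in `N` through
`y` and the frame `sᵢ` of the trivialisation of `TM` at `f y` (coefficient functionals `sⁱ`),
`D(ν ∘ c)/dt (0) = ∑ᵢ d(sⁱ(ν))_y(c' 0) sᵢ(f y) + ∑ᵢ sⁱ(ν y) ∇_{df_y (c' 0)} sᵢ`
(`covariantDerivAlong_comp_eq`: the chain rule for the coefficient functions `x ↦ sⁱ(ν x)` of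
the differentiable map `x ↦ (f x, ν x) ∈ TM`, and the chain rule `(f ∘ c)' = df (c')`,
O'Neill Ch. 1, (4) after Def. 17), which is visibly linear in the velocity `c' 0`; with `c` the
chart-straight curve of velocity `v` (`velocity_curveThrough_zero_holds`) this gives
`D_v ν = L v` for an explicit continuous linear map `L : T_y N →L[ℝ] T_{f y} M`
(`PseudoRiemannianMetric.normalDerivAlong_eq`). Finally, two linear functionals on `T_y N`
which agree on the basis `Module.finBasis` are equal (`secondFundamentalForm_apply_basis`,
`Module.Basis.ext`).

## References

* B. O'Neill, *Semi-Riemannian geometry with applications to relativity*, Academic Press 1983,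
  Ch. 1, Def. 17 ff. (velocity of a curve, its coordinate expression, `dφ(α') = (φ ∘ α)'`) and
  Exercise 5 (every tangent vector is a velocity); Ch. 3, Prop. 18 (p. 66, induced covariant
  derivative along a curve, coordinate formula); Ch. 4, Lemma 1, Cor. 2 and Lemma 4
  (pp. 98–100, induced connection on vector fields along a submanifold, `𝔉(M)`-linearity in
  `V`, pointwise character of the shape tensor).
-/

noncomputable section

open Bundle Set Filter
open scoped Manifold ContDiff Topology

namespace Literature.Geometry.Lorentzian

variable {E : Type*} [NormedAddCommGroup E] [NormedSpace ℝ E] {H : Type*} [TopologicalSpace H]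
  {I : ModelWithCorners ℝ E H} {M : Type*} [TopologicalSpace M] [ChartedSpace H M]

/-! ### The chart-straight curve at an interior point -/

section CurveThrough

variable [IsManifold I 1 M]

/-- **Every tangent vector at an interior point is a velocity.** At an interior point `x`, the
chart-straight curve `curveThrough I x v = (t ↦ φ⁻¹(φ x + t v))`, `φ = extChartAt I x`, is
differentiable at `t = 0` with derivative `t ↦ t • v` (chain rule: the affine curve
`t ↦ φ x + t v` has derivative `t ↦ t • v`, and the derivative of `φ⁻¹` at `φ x` is the identity
of `E = T_x M` — Mathlib's `mfderivWithin_range_extChartAt_symm`, the derivative within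
`range I` being the derivative since `range I` is a neighbourhood of `φ x` for interior `x`);
the same computation as the tree's `velocity_curveThrough_zero_holds`, recorded as a
`HasMFDerivAt` statement (differentiability *and* the derivative). O'Neill 1983, Ch. 1, Def. 17
(velocity, coordinate expression (2)) and Exercise 5 (given `v ∈ T_p M` there is a curve `α` with
`α'(0) = v`). [cite: ONeill1983, Ch. 1, Exercise 5] -/
theorem hasMFDerivAt_curveThrough_zero {x : M} (hx : I.IsInteriorPoint x)
    (v : TangentSpace I x) :
    HasMFDerivAt 𝓘(ℝ, ℝ) I (curveThrough I x v) 0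
      ((ContinuousLinearMap.id ℝ ℝ).smulRight (show E from v)) := by
  -- the straight line in the chart (`hasMFDerivAt_lineThrough` of `CurveThroughVelocity.lean`)
  have h₁ := hasMFDerivAt_lineThrough (extChartAt I x x) (show E from v) 0
  -- the inverse extended chart at the chart point of an interior point
  have h₂ : HasMFDerivAt 𝓘(ℝ, E) I (extChartAt I x).symm (extChartAt I x x)
      (ContinuousLinearMap.id ℝ (TangentSpace I x)) := by
    have h := (mdifferentiableWithinAt_extChartAt_symm (I := I)
      (mem_extChartAt_target x)).hasMFDerivWithinAt
    rw [mfderivWithin_range_extChartAt_symm] at h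
    exact h.hasMFDerivAt (range_mem_nhds_isInteriorPoint hx)
  have h₀ : extChartAt I x x + (0 : ℝ) • (show E from v) = extChartAt I x x := by simp
  rw [← h₀] at h₂
  exact (h₂.comp 0 h₁).congr_mfderiv (ContinuousLinearMap.ext fun _ ↦ rfl)

/-- The chart-straight curve through an interior point is differentiable at `t = 0`.
O'Neill 1983, Ch. 1, Exercise 5. [cite: ONeill1983, Ch. 1, Exercise 5] -/
theorem mdifferentiableAt_curveThrough_zero {x : M} (hx : I.IsInteriorPoint x)
    (v : TangentSpace I x) :
    MDifferentiableAt 𝓘(ℝ, ℝ) I (curveThrough I x v) 0 :=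
  (hasMFDerivAt_curveThrough_zero hx v).mdifferentiableAt

end CurveThrough

/-! ### The covariant derivative, along a curve, of a field along a map -/

section AlongMap

variable [IsManifold I ∞ M] [FiniteDimensional ℝ E]
  (cov : CovariantDerivative I E (TangentSpace I : M → Type _))
  {E' : Type*} [NormedAddCommGroup E'] [NormedSpace ℝ E'] {H' : Type*} [TopologicalSpace H']
  {I' : ModelWithCorners ℝ E' H'} {N : Type*} [TopologicalSpace N] [ChartedSpace H' N]

/-- **The frame formula for `D(ν ∘ c)/dt`.** Let `ν` be a field along `f : N → M`
(`ν x ∈ T_{f x} M`) and `c` a curve in `N`, differentiable at `0`, such that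
`x ↦ (f x, ν x) ∈ TM` is differentiable at `y = c 0`. In the frame `sᵢ` of the trivialisation
of `TM` at `f y` (coefficient functionals `sⁱ`), the covariant derivative at `t = 0` of the
vector field `t ↦ ν (c t)` along the curve `t ↦ f (c t)` is
`∑ᵢ d(sⁱ(ν))_y (c' 0) • sᵢ(f y) + ∑ᵢ sⁱ(ν y) • ∇_{df_y (c' 0)} sᵢ`:
the frame formula `Z' = ∑ (dZⁱ/dt) ∂ᵢ + ∑ Zⁱ D_{α'} ∂ᵢ` (O'Neill 1983, Ch. 3, Prop. 18) with
the chain rules `(d/dt) sⁱ(ν (c t)) = d(x ↦ sⁱ(ν x))(c')` and `(f ∘ c)' = df (c')`; this is the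
computation `D̄_V X̄ = ∑ V(fⁱ) ∂ᵢ + ∑ fⁱ D̄_V ∂ᵢ` of O'Neill 1983, Ch. 4, Lemma 1 (p. 98),
showing that `D_v ν` only depends on, and is linear in, the velocity `v = c' 0`. A cross-fibre
equation (both sides live in `E`; `c' 0 = velocity I' c 0 ∈ T_{c 0} N = E'`).
[cite: ONeill1983, Ch. 4, Lemma 1] -/
theorem covariantDerivAlong_comp_eq (f : N → M) (ν : Π x : N, TangentSpace I (f x))
    {c : ℝ → N} (hν : MDifferentiableAt I' I.tangent
      (fun x ↦ (TotalSpace.mk' E (f x) (ν x) : TangentBundle I M)) (c 0))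
    (hc : MDifferentiableAt 𝓘(ℝ, ℝ) I' c 0) :
    covariantDerivAlong cov (fun t ↦ f (c t)) (fun t ↦ ν (c t)) 0 =
      ∑ i, (show ℝ from mfderiv I' 𝓘(ℝ, ℝ)
          (fun x ↦ (trivializationAt E (TangentSpace I : M → Type _) (f (c 0))).localFrame_coeff
            I (Module.finBasis ℝ E) i (f x) (ν x)) (c 0) (velocity I' c 0)) •
          (trivializationAt E (TangentSpace I : M → Type _) (f (c 0))).localFrame
            (Module.finBasis ℝ E) i (f (c 0))
      + ∑ i, (trivializationAt E (TangentSpace I : M → Type _) (f (c 0))).localFrame_coeff I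
            (Module.finBasis ℝ E) i (f (c 0)) (ν (c 0)) •
          cov ((trivializationAt E (TangentSpace I : M → Type _) (f (c 0))).localFrame
            (Module.finBasis ℝ E) i) (f (c 0)) (mfderiv I' I f (c 0) (velocity I' c 0)) := by
  set e := trivializationAt E (TangentSpace I : M → Type _) (f (c 0)) with he_def
  set b := Module.finBasis ℝ E with hb_def
  -- differentiability of `f`, of the fibre coordinate of `ν` and of the coefficients `sⁱ(ν)`
  have hf : MDifferentiableAt I' I f (c 0) := ((mdifferentiableAt_totalSpace I _).1 hν).1
  have hνc : MDifferentiableAt I' 𝓘(ℝ, E)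
      (fun x ↦ (e (TotalSpace.mk' E (f x) (ν x) : TangentBundle I M)).2) (c 0) :=
    ((mdifferentiableAt_totalSpace I _).1 hν).2
  have hfe : ∀ᶠ x in 𝓝 (c 0), f x ∈ e.baseSet :=
    hf.continuousAt.preimage_mem_nhds
      (e.open_baseSet.mem_nhds (FiberBundle.mem_baseSet_trivializationAt' (f (c 0))))
  have hφ : ∀ i, MDifferentiableAt I' 𝓘(ℝ, ℝ) (fun x ↦ e.localFrame_coeff I b i (f x) (ν x))
      (c 0) := by
    intro i
    have h1 : MDifferentiableAt I' 𝓘(ℝ, ℝ)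
        (fun x ↦ b.coord i (e (TotalSpace.mk' E (f x) (ν x) : TangentBundle I M)).2) (c 0) :=
      (LinearMap.toContinuousLinearMap (b.coord i)).mdifferentiableAt.comp (c 0) hνc
    refine h1.congr_of_eventuallyEq ?_
    filter_upwards [hfe] with x hx
    rw [e.localFrame_coeff_eq_coeff (b := b) (s := fun _ ↦ ν x) hx]
    simp
  -- chain rule for `f ∘ c` (O'Neill Ch. 1, (4) after Def. 17)
  have hv : velocity I (fun t ↦ f (c t)) 0 = mfderiv I' I f (c 0) (velocity I' c 0) := by
    have h := mfderiv_comp 0 hf hc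
    simp only [velocity]
    rw [show (fun t ↦ f (c t)) = f ∘ c from rfl, h]
    rfl
  -- the frame formula, term by term
  show ∑ i, deriv (fun t ↦ e.localFrame_coeff I b i (f (c t)) (ν (c t))) 0 •
        e.localFrame b i (f (c 0)) +
      ∑ i, e.localFrame_coeff I b i (f (c 0)) (ν (c 0)) •
        cov (e.localFrame b i) (f (c 0)) (velocity I (fun t ↦ f (c t)) 0) = _
  rw [hv]
  congr 1
  refine Finset.sum_congr rfl fun i _ ↦ ?_
  rw [(hasDerivAt_comp_curve (hφ i) hc).deriv]

end AlongMap

/-! ### `D_v ν` is linear in `v`; the second fundamental form -/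

namespace PseudoRiemannianMetric

variable {E' : Type*} [NormedAddCommGroup E'] [NormedSpace ℝ E'] {H' : Type*}
  [TopologicalSpace H'] {I' : ModelWithCorners ℝ E' H'} {N : Type*} [TopologicalSpace N]
  [ChartedSpace H' N] [IsManifold I ∞ M] {n : ℕ∞ω} [FiniteDimensional ℝ E]
  (g : PseudoRiemannianMetric I n E (TangentSpace I : M → Type _)) [g.HasLeviCivita]

/-- **`D_v ν` in the canonical frame; linearity in `v`.** If `y` is an interior point of `N` and
the field `ν` along `f` is differentiable at `y` as a map `N → TM`, then for every `v ∈ T_y N`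
`D_v ν = ∑ᵢ d(sⁱ(ν))_y(v) • sᵢ(f y) + ∑ᵢ sⁱ(ν y) • ∇_{df_y v} sᵢ`
in the frame `sᵢ` of the trivialisation of `TM` at `f y` (`covariantDerivAlong_comp_eq` for the
chart-straight curve of velocity `v`, `velocity_curveThrough_zero_holds`); in particular
`v ↦ D_v ν` is (continuous) linear. O'Neill 1983, Ch. 4, Lemma 1 and Cor. 2 (1) (pp. 98–99:
`D̄_V X = ∑ V(fⁱ) ∂ᵢ + ∑ fⁱ D̄_V ∂ᵢ` is `𝔉(M)`-linear in `V`). [cite: ONeill1983, Ch. 4, Lemma 1] -/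
theorem normalDerivAlong_eq [IsManifold I' ∞ N] {f : N → M} {ν : NormalField I f} {y : N}
    (hy : I'.IsInteriorPoint y)
    (hν : MDifferentiableAt I' I.tangent
      (fun x ↦ (TotalSpace.mk' E (f x) (ν x) : TangentBundle I M)) y)
    (v : TangentSpace I' y) :
    g.normalDerivAlong f ν y v =
      ∑ i, (show ℝ from mfderiv I' 𝓘(ℝ, ℝ)
          (fun x ↦ (trivializationAt E (TangentSpace I : M → Type _) (f y)).localFrame_coeff I
            (Module.finBasis ℝ E) i (f x) (ν x)) y v) •
          (trivializationAt E (TangentSpace I : M → Type _) (f y)).localFrame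
            (Module.finBasis ℝ E) i (f y)
      + ∑ i, (trivializationAt E (TangentSpace I : M → Type _) (f y)).localFrame_coeff I
            (Module.finBasis ℝ E) i (f y) (ν y) •
          g.leviCivita ((trivializationAt E (TangentSpace I : M → Type _) (f y)).localFrame
            (Module.finBasis ℝ E) i) (f y) (mfderiv I' I f y v) := by
  have hν' : MDifferentiableAt I' I.tangent
      (fun x ↦ (TotalSpace.mk' E (f x) (ν x) : TangentBundle I M)) (curveThrough I' y v 0) := by
    rw [curveThrough_zero]
    exact hν
  have h := covariantDerivAlong_comp_eq g.leviCivita f ν hν'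
    (mdifferentiableAt_curveThrough_zero hy v)
  rw [curveThrough_zero, velocity_curveThrough_zero_holds hy v] at h
  exact h

variable {g} [FiniteDimensional ℝ E'] in
/-- **The second fundamental form is `g(D_v ν, df w)`** (discharge of the named fact
`secondFundamentalForm_apply`; the fact's own parameters `I'`, `g` are implicit here and are
determined by the expected type): at an interior point `y`, for a field `ν` along `f`
differentiable at `y` as a map `N → TM`, `K_ν(v, w) = g_{f y}(D_v ν, df_y w)` for all
`v, w ∈ T_y N`. Both sides are linear in `v` (`normalDerivAlong_eq`) and agree on the canonical
basis of `T_y N` (`secondFundamentalForm_apply_basis`). O'Neill 1983, Ch. 4, Lemma 1,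
Cor. 2 (1) and Lemma 4 (pp. 98–100: the shape tensor is `𝔉(M)`-bilinear, hence pointwise an
`ℝ`-bilinear function on `T_p M`); Wald 1984, (10.2.13).
[cite: ONeill1983, Ch. 4, Lemma 1 and Lemma 4] -/
theorem secondFundamentalForm_apply_holds : g.secondFundamentalForm_apply I' (N := N) := by
  intro _ f ν y hy hν v w
  haveI : FiniteDimensional ℝ (TangentSpace I' y) := inferInstanceAs (FiniteDimensional ℝ E')
  -- `D_u ν = L u` for the continuous linear map `L` read off from `normalDerivAlong_eq`
  let ψ : Fin (Module.finrank ℝ E) → (TangentSpace I' y →L[ℝ] ℝ) := fun i ↦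
    mfderiv I' 𝓘(ℝ, ℝ) (fun x ↦ (trivializationAt E (TangentSpace I : M → Type _)
      (f y)).localFrame_coeff I (Module.finBasis ℝ E) i (f x) (ν x)) y
  let L : TangentSpace I' y →L[ℝ] TangentSpace I (f y) :=
    ∑ i, (ψ i).smulRight ((trivializationAt E (TangentSpace I : M → Type _) (f y)).localFrame
        (Module.finBasis ℝ E) i (f y)) +
      ∑ i, (trivializationAt E (TangentSpace I : M → Type _) (f y)).localFrame_coeff I
          (Module.finBasis ℝ E) i (f y) (ν y) •
        (g.leviCivita ((trivializationAt E (TangentSpace I : M → Type _) (f y)).localFrame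
          (Module.finBasis ℝ E) i) (f y)).comp (mfderiv I' I f y)
  have hL : ∀ u, g.normalDerivAlong f ν y u = L u := fun u ↦ by
    rw [g.normalDerivAlong_eq hy hν u]
    simp only [L, ψ, add_apply, FunLike.coe_sum, Finset.sum_apply,
      ContinuousLinearMap.smulRight_apply, smul_apply, ContinuousLinearMap.comp_apply]
    rfl
  -- the linear functional `u ↦ g(L u, df w)` on `T_y N`
  let Φ : TangentSpace I' y →ₗ[ℝ] ℝ :=
    { toFun := fun u ↦ g.val (f y) (L u) (mfderiv I' I f y w)
      map_add' := fun u u' ↦ by simp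
      map_smul' := fun r u ↦ by simp }
  -- both sides of the claim are linear in `v` and agree on the basis `Module.finBasis` of `T_y N`
  suffices h : (g.secondFundamentalForm I' f ν y).flip w = Φ by
    have h' : g.secondFundamentalForm I' f ν y v w = Φ v := LinearMap.congr_fun h v
    rw [h', hL v]
    rfl
  refine (Module.finBasis ℝ (TangentSpace I' y)).ext fun i ↦ ?_
  change g.secondFundamentalForm I' f ν y (Module.finBasis ℝ (TangentSpace I' y) i) w =
    Φ (Module.finBasis ℝ (TangentSpace I' y) i)
  rw [secondFundamentalForm_apply_basis, hL]
  rfl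

end PseudoRiemannianMetric

end Literature.Geometry.Lorentzian

end
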